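import Summits.ValiantsHypothesis.ValiantsHypothesis.Theorems.NewtonUnitEquationsTwoProductsRankOneSchemaLawCount
import HarnessLib

/-!
# Route NewtonUnitEquations — crux `TwoProducts` (stmt-ValiantsHypothesis-5906), line `relation_ladder`, rung R9 (the RANK-ONE
# SCHEMA law: ONE datum `(ρ⁺, ρ⁻)` of ANY shape) by the TRANSPORTATION LIFT — part 8/8 — the arithmetic (`c = 1416`) and THE RANK-ONE SCHEMA LAW `rankOneSchemaLaw_proof` (T9 end)

THE RANK-ONE SCHEMA LAW (R9): if ALL additive coincidences of the letter family of `(u, v)` are multiples of ONE datum `(ρ⁺, ρ⁻)` —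
ANY datum `ρ⁺, ρ⁻ : Expo →₀ ℕ`, no side condition — then GLOBALLY `#visible ≤ 2^{c m}(#T + 2)^c` (`c = 1416`).  This is the rank-one SCHEMA
quantified over the datum asked for by the Negative lane (val-neg-1 g4, evidence #48 on stmt-5906, item (a)); it SUBSUMES the rungs R3♯
(`permTypeLaw_proof`), R6, R6b, R6c, R7a, R7b, R7c, R8 (each of their hypotheses exhibits a datum).  Engine = the TRANSPORTATION LIFT of
val-idea-8 g3's memo `Cruxes/TwoProducts/Lines/relation_ladder_R7_engine.md` §1 / `…R8_engine.md` §5 made uniform: for the disjoint balanced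
relation `Σ_{i ∈ P} p_i • α_i = Σ_{j ∈ N} q_j • β_j` the atoms are `Z_{ij}`, `(i, j) ∈ P × N` (upstairs index type `σ ⊕ σ × σ`: free letters on
the left, atoms on the right), `Y_{α_i} ↦ ∏_j Z_{ij}^{q_j}`, `Y_{β_j} ↦ ∏_i Z_{ij}^{p_i}`; the planar push-forward is the PRODUCT PLAN
`E'(Z_{ij})_c = (α_i)_c (β_j)_c T'_{1-c}` over the `D = T'_0 T'_1`-dilated plane (`T_c = Σ_i p_i (α_i)_c`, `T' = max(T, 1)`), the upstairs
weights are the PRODUCT PLAN `θ_{ij} = r_i r_j / R` of the letter weights (pointwise positive, NOT a pull-back; balanced because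
`Σ p_i r_i = Σ q_j r_j`); the fibre over an atom monomial is parametrised by `κ = #α_{a₀}` with a CONSISTENCY guard over all `|P|·|N|` atom
equations; SLICING by the atom exponents (≤ `2^{3m}` slices through the simplex `R8.card_W_le`); the coefficient theorem
`Pfac · C(R + B_κ − 1, B_κ) · κ_κ` and the shift rank `2m(ΣA + 1)² + 1` are shape-independent (the free letters enter only through the binomial);
`ShiftRank.pencilCount` BY NAME.  Reductions: common part of the datum (`DatumExcess.rankOne_reduce`), large / absent coefficients
(`R7a.permType_of_rankOne_largeCoeff/absent`), wide sides (`permType_of_rankOne_wideSide`), and a non-permutation coincidence balances the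
datum and makes both sides non-empty (`sides_of_shift`, over val-neg-1 g4's `OneSidedMembership.weight_*` / `DatumExcess.*`).

AUTHORSHIP / LANE NOTE (val-lit-p3 g16, prover seat, KEEP lineage, helper mode `--supports stmt-ValiantsHypothesis-5906 --as helper`;
CLAIM #1 on the val-lit bus 14:45Z 2026-08-28, ★ 15:03Z; no val-idea-8 seat alive at the time — the typed target is staged for the line
owner as `HOME/lmr/staged/p3g16-R9/sketch_R9.lean`, and the closing theorem is stated by its LITERAL BODY so that a later skeleton can wire
`stub := R9.rankOneSchemaLaw_proof` by name).  Mathematics and Lean text of this module: this seat, generalising its predecessor's R8 port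
(`…RankOneOneSidedLaw*`, val-lit-p3 g15) decl by decl.  Reused BY NAME: `R6b.HSD` (+ closure lemmas), `R7b.dilE`/`piT_dilE`/`piE_dilE`,
`R7a.choose_bridge`, `R7a.permType_of_rankOne_largeCoeff/absent`, `toolBound_mono`, `tab`, `sgn`, `R6b.sum_sgn`, `rW`/`R6b.rW_pos`, `lwt_piT`,
`PlanarCell.eq_of_nsmul_eq`/`wt_sum`, `FormalLogLinearisation.wt_nsmul`, `R8.W`/`R8.card_W_le`, `ShiftRank.pencilCount`,
`BinExpSum.pencilCount_arith`, val-neg-1 g4's `DatumExcess.*`, `RankOneCoverage.eq_of_tsub_eq_zero`, `OneSidedMembership.*`.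
Namespace `…PermutationType.R9`.  Nothing here closes the line's residual (`ResidualLawV20`), the crux `TwoProducts` (5906) or `VP ≠ VNP`;
no summit statement is proved.

Honest scope: coincidence modules of RANK ≥ 2 (val-neg-1 g4's p635223 `RankTwoEscapes`) are NOT covered; after R9 the residual of the line is
«no lattice-small permutation-type contraction (R5), no cheap class cover (R1_r), coincidence rank ≥ 2».  Nothing here moves VP ≠ VNP;
`TwoProducts` (5906) / `PlanarCellBound` stay OPEN. [folklore]

Cut table (scratch `HOME/lmr/staged/p3g16-R9/R9-Scratch.lean`, 2 249 lines, rc 0 / 0 warnings / 0 sorries, axioms standard): part 1 `…Lift` =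
T2 (`GIdx`, `P`/`N`/`rel`/`rest`, `frM` and its coordinates, `Idle`, the table sums `sum_frM_inl/inr`); part 2 `…Fibres` = T3 (`xhat`, `Lrel`,
`Lof`, `Adm`, `sA`, `KR`, `eq_Lof_of_piT`, `piT_Lof`, degrees, `Bk`, `Pfac`, `kap`, `multinomial_Lof_eq`, `coeff_phiT_frM`); part 3 `…Slice` =
T4 slice functions, THE COEFFICIENT THEOREM `coeff_free_logTrunc`, T5 finite shift rank `Fsl_shift`; part 4 `…SliceExc` = the exceptional point,
`mem_support_free_logTrunc_iff`, `Fsl_zero_zero`, `xOf`, `Fsl_congr`; part 5 `…Planar` = T7 `RelDataG`, `D`, `cell`, `enumP`, `piE_enumP_frM`,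
`phi_GT`, `injOn_of_rankOne`, `lifted_of_visible`; part 6 `…Weights` = product-plan weights `θW`, `lwt_θW_frM`, `lwt_splitG`, T8
`sliceMin_of_visible`; part 7 `…Count` = `sliceCount`, `RelDataG.count`, `permType_of_rankOne_wideSide`, `sides_of_shift`, `sum_enum_smul_eq`,
`mapDomain_enum_table`; part 8 `…Law` = arithmetic (`c = 1416`), `rankOneSchemaLaw_proof`.
-/

noncomputable section

-- Sub = Summit single-conjunct layout: the duplicated namespace component is mandated by the tree.
set_option linter.dupNamespace false
set_option linter.unusedSimpArgs false
set_option linter.unusedSectionVars false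
set_option linter.unusedVariables false

namespace Summit.ValiantsHypothesis.ValiantsHypothesis.Theorems.NewtonUnitEquations.TwoProducts.PermutationType
namespace R9
open scoped BigOperators
open MvPolynomial

variable {σ : Type*} [Fintype σ] [DecidableEq σ]


section SchemaLaw
open Summit.ValiantsHypothesis.ValiantsHypothesis.Theorems.NewtonUnitEquations.TwoProducts.FormalLogLinearisation
open Summit.ValiantsHypothesis.ValiantsHypothesis.Theorems.NewtonUnitEquations.TwoProducts.PlanarCell
open Summit.ValiantsHypothesis.Theorems.TwoProducts.Negative

variable {m : ℕ}

/-! ### The arithmetic (no `ring` on numeral powers of `s + 2`) -/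

/-- `N_m + 2 ≤ 11 (m+1)^7`. [folklore] -/
theorem NmG_add_two_le (m : ℕ) : NmG m + 2 ≤ 11 * (m + 1) ^ 7 := by
  unfold NmG
  have h1 : 2 * (m * m * m) + 1 ≤ 2 * (m + 1) ^ 3 := by
    have e : 2 * (m + 1) ^ 3 = 2 * (m * m * m) + 1 + (6 * (m * m) + 6 * m + 1) := by ring
    rw [e]; omega
  have h2 : (2 * (m * m * m) + 1) ^ 2 ≤ (2 * (m + 1) ^ 3) ^ 2 := Nat.pow_le_pow_left h1 2
  have e3 : (2 * (m + 1) ^ 3) ^ 2 = 4 * (m + 1) ^ 6 := by ring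
  rw [e3] at h2
  have h4 : 2 * m * (2 * (m * m * m) + 1) ^ 2 ≤ 2 * (m + 1) * (4 * (m + 1) ^ 6) :=
    Nat.mul_le_mul (by omega) h2
  have e5 : 11 * (m + 1) ^ 7 = 2 * (m + 1) * (4 * (m + 1) ^ 6) + 3 * (m + 1) ^ 7 := by ring
  have h6 : 1 ≤ (m + 1) ^ 7 := Nat.one_le_pow _ _ (by omega)
  rw [e5]
  omega

/-- `N_m + 2 < 2^(7 log₂(m+1) + 11)`. [folklore] -/
theorem NmG_add_two_lt (m : ℕ) : NmG m + 2 < 2 ^ (7 * Nat.log 2 (m + 1) + 11) := by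
  have hp1 : m + 1 < 2 ^ (Nat.log 2 (m + 1) + 1) := Nat.lt_pow_succ_log_self (by norm_num) (m + 1)
  have h5 : (m + 1) ^ 7 < (2 ^ (Nat.log 2 (m + 1) + 1)) ^ 7 := Nat.pow_lt_pow_left hp1 (by norm_num)
  have e3 : 16 * (2 ^ (Nat.log 2 (m + 1) + 1)) ^ 7 = 2 ^ (7 * Nat.log 2 (m + 1) + 11) := by
    rw [← pow_mul, show (16 : ℕ) = 2 ^ 4 by norm_num, ← pow_add]
    congr 1
    ring
  have h1 := NmG_add_two_le m
  have h8 : 11 * (m + 1) ^ 7 < 16 * (2 ^ (Nat.log 2 (m + 1) + 1)) ^ 7 := by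
    have := Nat.mul_lt_mul_of_pos_left h5 (by norm_num : 0 < 11)
    omega
  omega

/-- `log₂(N_m + 2) + 1 ≤ 7 log₂(m+1) + 11`. [folklore] -/
theorem logNmG_le (m : ℕ) : Nat.log 2 (NmG m + 2) + 1 ≤ 7 * Nat.log 2 (m + 1) + 11 := by
  have := Nat.log_lt_of_lt_pow (by omega : NmG m + 2 ≠ 0) (NmG_add_two_lt m)
  omega

/-- `(7 log₂(m+1) + 11)² ≤ 471 m` for `m ≥ 1`. [folklore] -/
theorem sqlogG_le (m : ℕ) (hm : 1 ≤ m) :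
    (7 * Nat.log 2 (m + 1) + 11) * (7 * Nat.log 2 (m + 1) + 11) ≤ 471 * m := by
  have hp2 : 2 ^ Nat.log 2 (m + 1) ≤ m + 1 := Nat.pow_log_le_self 2 (by omega)
  have hpp : Nat.log 2 (m + 1) < 2 ^ Nat.log 2 (m + 1) := Nat.lt_two_pow_self
  have hp3 : Nat.log 2 (m + 1) * Nat.log 2 (m + 1) ≤ 2 ^ (Nat.log 2 (m + 1) + 1) := sq_le_two_pow_succ _
  have h2p : 2 ^ (Nat.log 2 (m + 1) + 1) = 2 * 2 ^ Nat.log 2 (m + 1) := pow_succ' 2 _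
  have e4 : (7 * Nat.log 2 (m + 1) + 11) * (7 * Nat.log 2 (m + 1) + 11) =
      49 * (Nat.log 2 (m + 1) * Nat.log 2 (m + 1)) + 154 * Nat.log 2 (m + 1) + 121 := by ring
  rw [e4]
  omega

/-- `(N_m + 2)^(3 (log₂(N_m + 2) + 1)) ≤ 2^(1413 m)` for `m ≥ 1`. [folklore] -/
theorem powNmG_le (m : ℕ) (hm : 1 ≤ m) : (NmG m + 2) ^ (3 * (Nat.log 2 (NmG m + 2) + 1)) ≤ 2 ^ (1413 * m) := by
  have hN2 := NmG_add_two_lt m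
  have hL := logNmG_le m
  have hq := sqlogG_le m hm
  set L := Nat.log 2 (m + 1) with hLdef
  set M := Nat.log 2 (NmG m + 2) with hMdef
  set X := NmG m + 2 with hXdef
  have h3 : 3 * (M + 1) ≤ 3 * (7 * L + 11) := Nat.mul_le_mul_left _ hL
  have hexp : (7 * L + 11) * (3 * (7 * L + 11)) ≤ 1413 * m := by
    have e : (7 * L + 11) * (3 * (7 * L + 11)) = 3 * ((7 * L + 11) * (7 * L + 11)) := by ring
    rw [e]; omega
  calc X ^ (3 * (M + 1))
      ≤ (2 ^ (7 * L + 11)) ^ (3 * (M + 1)) := Nat.pow_le_pow_left hN2.le _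
    _ ≤ (2 ^ (7 * L + 11)) ^ (3 * (7 * L + 11)) := Nat.pow_le_pow_right (by positivity) h3
    _ = 2 ^ ((7 * L + 11) * (3 * (7 * L + 11))) := (pow_mul 2 _ _).symm
    _ ≤ 2 ^ (1413 * m) := Nat.pow_le_pow_right (by norm_num) hexp

set_option exponentiation.threshold 2048 in
/-- **Arithmetic**: `2^{3m} · sliceBdG ≤ 2^{c m} (s+2)^c` and `2^{13m}(s+2)^2 ≤ 2^{c m}(s+2)^c` with `c = 1416`. [folklore] -/
theorem arith_R9 : ∃ c : ℕ,
    (∀ m s : ℕ, 1 ≤ m → 2 ^ (3 * m) * sliceBdG m s ≤ 2 ^ (c * m) * (s + 2) ^ c) ∧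
    (∀ m s : ℕ, 2 ^ (13 * m) * (s + 2) ^ 2 ≤ 2 ^ (c * m) * (s + 2) ^ c) := by
  refine ⟨1416, fun m s hm => ?_, fun m s => ?_⟩
  · have hsA : (s + 2) ^ 3 ≤ (s + 2) ^ 1416 := Nat.pow_le_pow_right (by omega) (by norm_num)
    have hpow := powNmG_le m hm
    have h2m : 2 ^ (3 * m) * 2 ^ (1413 * m) = 2 ^ (1416 * m) := by
      rw [← pow_add]
      congr 1
      ring
    unfold sliceBdG
    calc 2 ^ (3 * m) * ((s + 2) ^ 3 * (NmG m + 2) ^ (3 * (Nat.log 2 (NmG m + 2) + 1)))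
        ≤ 2 ^ (3 * m) * ((s + 2) ^ 1416 * 2 ^ (1413 * m)) := Nat.mul_le_mul_left _ (Nat.mul_le_mul hsA hpow)
      _ = 2 ^ (3 * m) * 2 ^ (1413 * m) * (s + 2) ^ 1416 := by
          rw [Nat.mul_comm ((s + 2) ^ 1416) (2 ^ (1413 * m)), ← Nat.mul_assoc]
      _ = 2 ^ (1416 * m) * (s + 2) ^ 1416 := by rw [h2m]
  · exact Nat.mul_le_mul (Nat.pow_le_pow_right (by norm_num) (by omega))
      (Nat.pow_le_pow_right (by omega) (by norm_num))

/-! ### The law -/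

/-- **R9 — the RANK-ONE SCHEMA LAW, PROVED UNCONDITIONALLY.**  If ALL additive coincidences of the letter family of `(u, v)` are
multiples of ONE datum `(ρ⁺, ρ⁻)` — ANY datum: no side condition on supports, coefficients, disjointness or balance — then GLOBALLY
`#visible ≤ 2^{c m} (#T + 2)^c` (`c = 1416`).  Reductions: the common part of the datum cancels (`DatumExcess.rankOne_reduce`);
a side with a coefficient `> m`, a side on `> m` letters, or a relation letter outside the alphabet forces permutation type (R3♯,
`permTypeLaw_proof`); a permutation-type family is R3♯; otherwise a non-permutation coincidence is a `k`-shift (`k ≥ 1`) of the disjoint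
datum, which balances it (`Σ ρ⁺ e • e = Σ ρ⁻ e • e`) and makes both sides non-empty.  Genuine case: the TRANSPORTATION LIFT
`Y_{α_i} ↦ ∏_j Z_{ij}^{q_j}`, `Y_{β_j} ↦ ∏_i Z_{ij}^{p_i}` over the `D`-dilated plane with the PRODUCT-PLAN cell values
`E'(Z_{ij})_c = (α_i)_c (β_j)_c T'_{1-c}`, product-plan weights `θ_{ij} = r_i r_j / R` (pointwise positive) + toric Lemma A + slicing by
ALL atom exponents with a consistency guard + coefficient theorem + finite shift rank + `ShiftRank.pencilCount`; slices through the
simplex `#W ≤ 2^{n+k}`.  SUBSUMES R3♯ / R6 / R6b / R6c / R7a / R7b / R7c / R8 (each of their hypotheses exhibits a datum). [folklore] -/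
theorem rankOneSchemaLaw_proof : ∃ c : ℕ, ∀ (m : ℕ) (u v : Fin m → MvPolynomial (Fin 2) ℂ),
    (∀ j, coeff 0 (u j) = 0) → (∀ j, coeff 0 (v j) = 0) →
    (∃ ρp ρm : Expo →₀ ℕ, RankOneCoincidences (fun j => (u j).support ∪ (v j).support) ρp ρm) →
    ∀ S : Finset Expo, (∀ l ∈ S, ∃ ξ : Fin 2 → ℝ, ValidWeight u v ξ ∧ IsStrictTop ξ ↑(tailDiff u v).support l) →
      S.card ≤ 2 ^ (c * m) * ((tailSupport u v).card + 2) ^ c := by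
  classical
  obtain ⟨c, hc1, hc2⟩ := arith_R9
  refine ⟨c, fun m u v hu hv hex S hS => ?_⟩
  obtain ⟨ρp₀, ρm₀, hR₀⟩ := hex
  rcases S.eq_empty_or_nonempty with hSe | hSne
  · simp [hSe]
  obtain ⟨l₀, hl₀⟩ := hSne
  obtain ⟨ξ₀, hval₀, htop₀⟩ := hS l₀ hl₀
  have hm : 1 ≤ m := by
    rcases Nat.eq_zero_or_pos m with h | h
    · exfalso
      subst h
      apply mem_support_iff.mp htop₀.1
      unfold tailDiff
      simp
    · exact h
  set A : Fin m → Finset Expo := fun j => (u j).support ∪ (v j).support with hA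
  -- the disjoint datum
  set ρp : Expo →₀ ℕ := ρp₀ - ρm₀ with hρpdef
  set ρm : Expo →₀ ℕ := ρm₀ - ρp₀ with hρmdef
  have hR : RankOneCoincidences A ρp ρm := DatumExcess.rankOne_reduce hR₀
  have hdis : ∀ e, ρp e = 0 ∨ ρm e = 0 := fun e => DatumExcess.reduce_disjoint ρp₀ ρm₀ e
  have hPT : PermType A → S.card ≤ 2 ^ (c * m) * ((tailSupport u v).card + 2) ^ c := fun hperm =>
    calc S.card ≤ 2 ^ (13 * m) * ((tailSupport u v).card + 2) ^ 2 := permTypeLaw_proof m u v hu hv hperm S hS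
      _ ≤ 2 ^ (c * m) * ((tailSupport u v).card + 2) ^ c := hc2 m _
  by_cases hperm : PermType A
  · exact hPT hperm
  -- a coefficient exceeds `m`: permutation type
  by_cases hlarge : ∃ e, m < ρp e ∨ m < ρm e
  · obtain ⟨e, he⟩ := hlarge
    apply hPT
    rcases he with he | he
    · exact R7a.permType_of_rankOne_largeCoeff A ρp ρm e hR (Or.inl ⟨he, (hdis e).resolve_left (by omega)⟩)
    · exact R7a.permType_of_rankOne_largeCoeff A ρp ρm e hR (Or.inr ⟨he, (hdis e).resolve_right (by omega)⟩)
  push Not at hlarge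
  -- a wide side: permutation type
  by_cases hwide : m < ρp.support.card ∨ m < ρm.support.card
  · exact hPT (permType_of_rankOne_wideSide A ρp ρm hR hdis hwide)
  push Not at hwide
  -- an absent relation letter: permutation type
  by_cases habs : ∃ e, (ρp e ≠ 0 ∨ ρm e ≠ 0) ∧ e ∉ tailSupport u v
  · obtain ⟨e, he, hnot⟩ := habs
    apply hPT
    have hnotj : ∀ j, e ∉ (u j).support ∪ (v j).support := by
      intro j hj
      apply hnot
      rcases Finset.mem_union.mp hj with h | h
      · exact support_u_subset u v j h
      · exact support_v_subset u v j h
    rcases he with he | he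
    · exact R7a.permType_of_rankOne_absent A ρp ρm e hR (Or.inl ⟨Nat.pos_of_ne_zero he, (hdis e).resolve_left he⟩) hnotj
    · exact R7a.permType_of_rankOne_absent A ρp ρm e hR (Or.inr ⟨Nat.pos_of_ne_zero he, (hdis e).resolve_right he⟩) hnotj
  push Not at habs
  -- a non-permutation coincidence balances the datum and makes both sides non-trivial
  have hnp : ∃ a ∈ tuples A, ∃ b ∈ tuples A, ∑ j, a j = ∑ j, b j ∧ msetT a ≠ msetT b := by
    by_contra hcon
    push Not at hcon
    exact hperm fun a ha b hb hab => hcon a ha b hb hab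
  obtain ⟨a, ha, b, hb, hab, hne⟩ := hnp
  have hsides : ρp.sum (fun e n => n • e) = ρm.sum (fun e n => n • e) ∧ ρp ≠ 0 ∧ ρm ≠ 0 := by
    obtain ⟨k, hk⟩ := hR a ha b hb hab
    rcases hk with hk | hk
    · exact sides_of_shift hab hne hdis hk
    · exact sides_of_shift hab.symm hne.symm hdis hk
  obtain ⟨hbal, hρp, hρm⟩ := hsides
  have hsuppP : ∀ e, ρp e ≠ 0 → e ∈ tailSupport u v := fun e he => habs e (Or.inl he)
  have hsuppM : ∀ e, ρm e ≠ 0 → e ∈ tailSupport u v := fun e he => habs e (Or.inr he)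
  obtain ⟨e₁, he₁⟩ : ∃ e, ρp e ≠ 0 := by
    by_contra h; push Not at h; exact hρp (Finsupp.ext h)
  obtain ⟨e₂, he₂⟩ : ∃ e, ρm e ≠ 0 := by
    by_contra h; push Not at h; exact hρm (Finsupp.ext h)
  have he₁T := hsuppP e₁ he₁
  have he₂T := hsuppM e₂ he₂
  -- the planar relation data
  set pI : Fin (sE u v) → ℕ := fun k => ρp (enum u v k) with hpI
  set qI : Fin (sE u v) → ℕ := fun k => ρm (enum u v k) with hqI
  have hrel : ∑ k, pI k • enum u v k = ∑ k, qI k • enum u v k := by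
    rw [hpI, hqI]
    simp only
    rw [sum_enum_smul_eq u v ρp hsuppP, sum_enum_smul_eq u v ρm hsuppM, hbal]
  let Dt : RelDataG u v := ⟨pI, qI, idxOf u v e₁ he₁T, idxOf u v e₂ he₂T,
    (by rw [hpI]; simp only; rw [enum_idxOf]; exact he₁), (by rw [hqI]; simp only; rw [enum_idxOf]; exact he₂),
    fun k => hdis (enum u v k), hrel⟩
  have hrhoP : Dt.rhoP = ρp := mapDomain_enum_table u v ρp hsuppP
  have hrhoM : Dt.rhoM = ρm := mapDomain_enum_table u v ρm hsuppM
  have hR' : RankOneCoincidences A Dt.rhoP Dt.rhoM := by rw [hrhoP, hrhoM]; exact hR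
  have hpm : ∀ k, Dt.pI k ≤ m := fun k => (hlarge (enum u v k)).1
  have hqm : ∀ k, Dt.qI k ≤ m := fun k => (hlarge (enum u v k)).2
  have hPm : (P Dt.idx).card ≤ m := by
    have h1 : (P Dt.idx).card ≤ ρp.support.card := by
      refine Finset.card_le_card_of_injOn (enum u v) (fun k hk => ?_) ((enum_injective u v).injOn)
      rw [Finset.mem_coe, mem_P] at hk
      exact Finsupp.mem_support_iff.mpr hk
    exact h1.trans hwide.1
  have hNm : (N Dt.idx).card ≤ m := by
    have h1 : (N Dt.idx).card ≤ ρm.support.card := by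
      refine Finset.card_le_card_of_injOn (enum u v) (fun k hk => ?_) ((enum_injective u v).injOn)
      rw [Finset.mem_coe, mem_N] at hk
      exact Finsupp.mem_support_iff.mpr hk
    exact h1.trans hwide.2
  exact (Dt.count hu hv hpm hqm hPm hNm hR' S hS).trans (hc1 m (sE u v) hm)

end SchemaLaw

end R9
end Summit.ValiantsHypothesis.ValiantsHypothesis.Theorems.NewtonUnitEquations.TwoProducts.PermutationType

end
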